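import Summits.QuantumFields.BalabanUV.Beta.WardBorderNoTwinModel

/-!
# `BalabanUV.Beta.WardBorderNoTwinParity` — binder row D1, (L4) W-side of hW: **NO TWIN MODEL OF THE hW BORDER WARD LETTER IN THE EVEN-HALF
# (PARITY) CURRENCY** of leaf-06-g3's `WardLocusParitySplit.wardTransversal_flipK_TbalOf_JsRecWAtOf_TW_su_of_evenHalf_laws` (p220943), every wall `2 ≤ Lc`

HONEST FRAMING (cell charter, verbatim): «discharging BetaPertH makes Balaban's UV stability UNCONDITIONAL — a real
constructive-QFT result; it is NOT the continuum limit and NOT the Clay problem.»  [folklore] entrywise kernel algebra over this lineage's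
`WardBorderNoTwinModel` (the return-contour witness `vhSAt_ctr_next_ne_zero`, the block-`0` leg counts `legIndSum_root_inr`∕`legIndSum_next_inl`), BY
NAME; no statement of Bałaban's papers, no `[cite:]`, no `def`, no `Prop` fact; instantiates NO binder of the β-function wall (0/4: hW, hR, D1Tel, D1Rep).
It shows that the EVEN-HALF border law `L + sgnK (trK L) = 2 • [c′ • vhSAt ρ_c κ′ u′, D(Y)]` (hE0 / hES of p220943, VERBATIM shapes at `d = e + 2`, centred root)
has NO model with a border-TWIN table `vh₂S`: a twin left side has even half `0` at the mirrored witness entries while the commutator entry at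
`(ρ_c + Lc·e_μ, inl τ; 0, inr μ)` is `c′/2 · vhSAt(…) ≠ 0`.  (The hR-side entries of p219249 ∕ `AveragingBorderWitness` do NOT serve here: for the BLOCK
generator both their legs sit in block `0` and `D` cancels.)  NOT hW, NOT D1, NOT `BetaPertH`, NOT continuum, NOT Clay.
HONEST DEPENDENCY: continuum YM on T⁴ ⇐ BetaPertH ∧ nine spine estimates (0/9 proved); BetaPertH ⇐ (D1) ∧ (D4) ∧ CAP+tail;
G-an2-4 gates asym, D1 and NE2/3/4.

* `no_twin_ward_border_evenHalf_law` (core): a kernel `Lκ` that is twin at the two mirrored witness entries cannot satisfy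
  `Lκ + sgnK (trK Lκ) = 2 • (comp (c′ • S) D₀ − comp D₀ (c′ • S))`, `S = vhSAt ρ_c τ (ρ_c + L·e_μ)`, `c′ ≠ 0`, `2 ≤ L`.
* `no_twin_ward_border_evenHalf_model_zero` ∕ `_succ` (hE0 ∕ hES shapes, any `cB`, border-twin `vh₂S`) and the wall's `d = 3` instances.
Provenance: β sub-cell, D1 formalisation swarm, unit b2b-balaban-beta-d1-formalise-leaf-04 gen 4, 2026-08-20 (v1); no existing file touched.
-/

open Finset
open scoped BigOperators
open Literature.MathematicalPhysics.QuantumFieldTheory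
open Literature.MathematicalPhysics.QuantumFieldTheory.Balaban1983to89
open Literature.MathematicalPhysics.QuantumFieldTheory.Balaban1983to89.Beta
open Literature.MathematicalPhysics.QuantumFieldTheory.Balaban1983to89.Beta.AffineAveraging
open Literature.MathematicalPhysics.QuantumFieldTheory.Balaban1983to89.Beta.AveragingContoursRooted
open Literature.MathematicalPhysics.QuantumFieldTheory.Balaban1983to89.Beta.AveragingHessianKernelsRooted
open ExpKernelCalculus (MKer comp)
open KernelWard (divV)
open OneStepResolventKernel (Fib)
open BalabanStepJetsSucc (wVH)
open BalabanStepW2 (wB2)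
open Summit.QuantumFields.BalabanUV.Beta.TameKernelCalculus
open Summit.QuantumFields.BalabanUV.Beta.BorderedHessian (sgnK sgnK_apply sgnF_inl sgnF_inr diagK comp_diagK_left comp_diagK_right stepScale)
open Summit.QuantumFields.BalabanUV.Beta.AveragingWardRootedStencils (legInd)
open Summit.QuantumFields.BalabanUV.Beta.WardBorderNoTwinModel

namespace Summit.QuantumFields.BalabanUV.Beta.WardBorderNoTwinParity

noncomputable section

variable {e L : ℕ} {τ μ : Fin (e + 3)}

/-- [folklore] **THE CORE IN THE EVEN-HALF CURRENCY**: for `2 ≤ L`, `μ ≠ τ` and `c′ ≠ 0`, a kernel `Lκ` taking the same value at the two mirrored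
witness entries `(ρ_c + L·e_μ, inl τ; 0, inr μ)` / `(0, inr μ; ρ_c + L·e_μ, inl τ)` cannot satisfy the even-half border law
`Lκ + sgnK (trK Lκ) = 2 • (comp (c′ • S) D₀ − comp D₀ (c′ • S))` with `S = vhSAt ρ_c τ (ρ_c + L·e_μ)`, `D₀` the block-`0` leg generator: at the first
entry the left side is `Lκ₁ − Lκ₂ = 0` (`sgnF inl · sgnF inr = −1`) and the right side is `2 · (c′ S /2 − 0) = c′ S ≠ 0`. -/
theorem no_twin_ward_border_evenHalf_law (hL : 2 ≤ L) (hτ : (τ : ℕ) = e + 2) (hμτ : μ ≠ τ) {c' : ℝ} (hc' : c' ≠ 0)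
    {Lκ : MKer (e + 3) (Fib (e + 2))}
    (hLtw : Lκ 0 (toSite (ctrOff (e + 3) L) + (L : ℤ) • unitVec μ) (Sum.inr μ) (Sum.inl τ) =
      Lκ (toSite (ctrOff (e + 3) L) + (L : ℤ) • unitVec μ) 0 (Sum.inl τ) (Sum.inr μ))
    (h : Lκ + sgnK (trK Lκ) = (2 : ℝ) •
      (comp (c' • vhSAt (toSite (ctrOff (e + 3) L)) (e + 2) L rfl τ (toSite (ctrOff (e + 3) L) + (L : ℤ) • unitVec μ))
          (diagK (((1 : ℝ) / 2) • ∑ v ∈ box (e + 3) L, legInd (toSite (ctrOff (e + 3) L)) ((L : ℤ) • (0 : Fin (e + 3) → ℤ) + toSite v)))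
        - comp (diagK (((1 : ℝ) / 2) • ∑ v ∈ box (e + 3) L, legInd (toSite (ctrOff (e + 3) L)) ((L : ℤ) • (0 : Fin (e + 3) → ℤ) + toSite v)))
          (c' • vhSAt (toSite (ctrOff (e + 3) L)) (e + 2) L rfl τ (toSite (ctrOff (e + 3) L) + (L : ℤ) • unitVec μ)))) : False := by
  have hL1 : 1 ≤ L := by omega
  set x₀ : Fin (e + 3) → ℤ := toSite (ctrOff (e + 3) L) + (L : ℤ) • unitVec μ with hx₀
  set S := vhSAt (toSite (ctrOff (e + 3) L)) (e + 2) L rfl τ x₀ with hS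
  have hne : S x₀ 0 (Sum.inl τ) (Sum.inr μ) ≠ 0 := vhSAt_ctr_next_ne_zero hL hτ hμτ
  have g1 := legIndSum_root_inr (e := e) hL1 μ
  have g2 : (∑ v ∈ box (e + 3) L, legInd (toSite (ctrOff (e + 3) L)) ((L : ℤ) • (0 : Fin (e + 3) → ℤ) + toSite v))
      x₀ (Sum.inl τ) = 0 := legIndSum_next_inl (e := e) L τ μ
  have e1 := congrArg (fun K : MKer (e + 3) (Fib (e + 2)) => K x₀ 0 (Sum.inl τ) (Sum.inr μ)) h
  simp only [Pi.add_apply, Pi.sub_apply, Pi.smul_apply, smul_eq_mul, sgnK_apply, trK_apply, sgnF_inl, sgnF_inr,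
    comp_diagK_right, comp_diagK_left, g1, g2, hLtw] at e1
  have h0 : c' * S x₀ 0 (Sum.inl τ) (Sum.inr μ) = 0 := by linarith
  exact hne ((mul_eq_zero.1 h0).resolve_left hc')

/-- [folklore] **NO TWIN MODEL OF THE LEVEL-`0` EVEN-HALF BORDER LAW — EVERY WALL `2 ≤ Lc`** (the hE0 binder of
`WardLocusParitySplit.…_TW_su_of_evenHalf_laws` p220943, VERBATIM SHAPE at `d = e + 2`, centred root, ANY `cB`), border-TWIN `vh₂S` (K-E's hypothesis shape). -/
theorem no_twin_ward_border_evenHalf_model_zero [NeZero L] (hL : 2 ≤ L) (hτ : (τ : ℕ) = e + 2) (hμτ : μ ≠ τ) (cB : ℝ)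
    {vh₂S : Fin (e + 3) → (Fin (e + 3) → ℤ) → Fin (e + 3) → (Fin (e + 3) → ℤ) → MKer (e + 3) (Fib (e + 2))}
    (hBtw : ∀ κ u κ' u' (x z : Fin (e + 3) → ℤ) (β m : Fin (e + 3)),
      vh₂S κ u κ' u' z x (Sum.inr m) (Sum.inl β) = vh₂S κ u κ' u' x z (Sum.inl β) (Sum.inr m))
    (hE0 : ∀ (Y : Fin (e + 3) → ℤ) (κ' : Fin (e + 3)) (u' : Fin (e + 3) → ℤ),
      (stepScale (e + 2) L 0 * (L : ℝ) ^ (e + 3))⁻¹ • ∑ v ∈ box (e + 3) L, divV (fun κ u => cB • vh₂S κ u κ' u') ((L : ℤ) • Y + toSite v)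
          + sgnK (trK ((stepScale (e + 2) L 0 * (L : ℝ) ^ (e + 3))⁻¹ • ∑ v ∈ box (e + 3) L, divV (fun κ u => cB • vh₂S κ u κ' u') ((L : ℤ) • Y + toSite v))) =
        (2 : ℝ) • (comp ((-((L : ℝ) ^ (e + 3) * (1 / 2) * (L : ℝ) ^ (e + 3))) • vhSAt (toSite (ctrOff (e + 3) L)) (e + 2) L rfl κ' u')
            (diagK (((1 : ℝ) / 2) • ∑ v ∈ box (e + 3) L, legInd (toSite (ctrOff (e + 3) L)) ((L : ℤ) • Y + toSite v)))
          - comp (diagK (((1 : ℝ) / 2) • ∑ v ∈ box (e + 3) L, legInd (toSite (ctrOff (e + 3) L)) ((L : ℤ) • Y + toSite v)))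
            ((-((L : ℝ) ^ (e + 3) * (1 / 2) * (L : ℝ) ^ (e + 3))) • vhSAt (toSite (ctrOff (e + 3) L)) (e + 2) L rfl κ' u'))) : False := by
  have hL0 : (L : ℝ) ≠ 0 := Nat.cast_ne_zero.2 (by omega)
  have hc' : (-((L : ℝ) ^ (e + 3) * (1 / 2) * (L : ℝ) ^ (e + 3))) ≠ 0 :=
    neg_ne_zero.2 (mul_ne_zero (mul_ne_zero (pow_ne_zero _ hL0) (by norm_num)) (pow_ne_zero _ hL0))
  set x₀ : Fin (e + 3) → ℤ := toSite (ctrOff (e + 3) L) + (L : ℤ) • unitVec μ with hx₀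
  have hV : ∀ κ u (x z : Fin (e + 3) → ℤ) (β m : Fin (e + 3)),
      (cB • vh₂S κ u τ x₀) z x (Sum.inr m) (Sum.inl β) = (cB • vh₂S κ u τ x₀) x z (Sum.inl β) (Sum.inr m) := by
    intro κ u x z β m
    simp only [Pi.smul_apply, hBtw]
  have htw := smul_sum_divV_twin (box (e + 3) L) (fun v => (L : ℤ) • (0 : Fin (e + 3) → ℤ) + toSite v)
    ((stepScale (e + 2) L 0 * (L : ℝ) ^ (e + 3))⁻¹) (V := fun κ u => cB • vh₂S κ u τ x₀) hV x₀ 0 τ μ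
  exact no_twin_ward_border_evenHalf_law hL hτ hμτ hc' htw (hE0 0 τ x₀)

/-- [folklore] **NO TWIN MODEL OF THE LEVEL-`(j+1)` EVEN-HALF BORDER LAW — EVERY WALL `2 ≤ Lc`, EVERY LEVEL** (the hES binder of p220943 at one level
`j + 1`, VERBATIM SHAPE at `d = e + 2`, centred root, ANY `cB`; weights `cB·wB2 (j+1)` and `c′·wVH (j+1)`). -/
theorem no_twin_ward_border_evenHalf_model_succ [NeZero L] (hL : 2 ≤ L) (hτ : (τ : ℕ) = e + 2) (hμτ : μ ≠ τ) (cB : ℝ) (j : ℕ)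
    {vh₂S : Fin (e + 3) → (Fin (e + 3) → ℤ) → Fin (e + 3) → (Fin (e + 3) → ℤ) → MKer (e + 3) (Fib (e + 2))}
    (hBtw : ∀ κ u κ' u' (x z : Fin (e + 3) → ℤ) (β m : Fin (e + 3)),
      vh₂S κ u κ' u' z x (Sum.inr m) (Sum.inl β) = vh₂S κ u κ' u' x z (Sum.inl β) (Sum.inr m))
    (hES : ∀ (Y : Fin (e + 3) → ℤ) (κ' : Fin (e + 3)) (u' : Fin (e + 3) → ℤ),
      (stepScale (e + 2) L (j + 1) * (L : ℝ) ^ (e + 3))⁻¹ •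
            ∑ v ∈ box (e + 3) L, divV (fun κ u => (cB * wB2 (e + 2) L (j + 1)) • vh₂S κ u κ' u') ((L : ℤ) • Y + toSite v)
          + sgnK (trK ((stepScale (e + 2) L (j + 1) * (L : ℝ) ^ (e + 3))⁻¹ •
            ∑ v ∈ box (e + 3) L, divV (fun κ u => (cB * wB2 (e + 2) L (j + 1)) • vh₂S κ u κ' u') ((L : ℤ) • Y + toSite v))) =
        (2 : ℝ) • (comp ((-((L : ℝ) ^ (e + 3) * (1 / 2) * (L : ℝ) ^ (e + 3)) * wVH (e + 2) L (j + 1)) •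
              vhSAt (toSite (ctrOff (e + 3) L)) (e + 2) L rfl κ' u')
            (diagK (((1 : ℝ) / 2) • ∑ v ∈ box (e + 3) L, legInd (toSite (ctrOff (e + 3) L)) ((L : ℤ) • Y + toSite v)))
          - comp (diagK (((1 : ℝ) / 2) • ∑ v ∈ box (e + 3) L, legInd (toSite (ctrOff (e + 3) L)) ((L : ℤ) • Y + toSite v)))
            ((-((L : ℝ) ^ (e + 3) * (1 / 2) * (L : ℝ) ^ (e + 3)) * wVH (e + 2) L (j + 1)) •
              vhSAt (toSite (ctrOff (e + 3) L)) (e + 2) L rfl κ' u'))) : False := by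
  have hL0 : (L : ℝ) ≠ 0 := Nat.cast_ne_zero.2 (by omega)
  have hw : wVH (e + 2) L (j + 1) ≠ 0 := by
    unfold BalabanStepJetsSucc.wVH
    exact pow_ne_zero _ (pow_ne_zero _ hL0)
  have hc' : (-((L : ℝ) ^ (e + 3) * (1 / 2) * (L : ℝ) ^ (e + 3))) * wVH (e + 2) L (j + 1) ≠ 0 :=
    mul_ne_zero (neg_ne_zero.2 (mul_ne_zero (mul_ne_zero (pow_ne_zero _ hL0) (by norm_num)) (pow_ne_zero _ hL0))) hw
  set x₀ : Fin (e + 3) → ℤ := toSite (ctrOff (e + 3) L) + (L : ℤ) • unitVec μ with hx₀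
  have hV : ∀ κ u (x z : Fin (e + 3) → ℤ) (β m : Fin (e + 3)),
      ((cB * wB2 (e + 2) L (j + 1)) • vh₂S κ u τ x₀) z x (Sum.inr m) (Sum.inl β) =
        ((cB * wB2 (e + 2) L (j + 1)) • vh₂S κ u τ x₀) x z (Sum.inl β) (Sum.inr m) := by
    intro κ u x z β m
    simp only [Pi.smul_apply, hBtw]
  have htw := smul_sum_divV_twin (box (e + 3) L) (fun v => (L : ℤ) • (0 : Fin (e + 3) → ℤ) + toSite v)
    ((stepScale (e + 2) L (j + 1) * (L : ℝ) ^ (e + 3))⁻¹) (V := fun κ u => (cB * wB2 (e + 2) L (j + 1)) • vh₂S κ u τ x₀) hV x₀ 0 τ μ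
  exact no_twin_ward_border_evenHalf_law hL hτ hμτ hc' htw (hES 0 τ x₀)

/-- [folklore] **THE WALL'S `d = 3` INSTANCE, LEVEL `0`** (`τ = 3`, `μ = 0`; hE0 of p220943 at `r := ctrOff 4 Lc`). -/
theorem no_twin_ward_border_evenHalf_model_zero_three {Lc : ℕ} [NeZero Lc] (hLc : 2 ≤ Lc) (cB : ℝ)
    {vh₂S : Fin 4 → (Fin 4 → ℤ) → Fin 4 → (Fin 4 → ℤ) → MKer 4 (Fib 3)}
    (hBtw : ∀ κ u κ' u' (x z : Fin 4 → ℤ) (β m : Fin 4),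
      vh₂S κ u κ' u' z x (Sum.inr m) (Sum.inl β) = vh₂S κ u κ' u' x z (Sum.inl β) (Sum.inr m))
    (hE0 : ∀ (Y : Fin 4 → ℤ) (κ' : Fin 4) (u' : Fin 4 → ℤ),
      (stepScale 3 Lc 0 * (Lc : ℝ) ^ (3 + 1))⁻¹ • ∑ v ∈ box (3 + 1) Lc, divV (fun κ u => cB • vh₂S κ u κ' u') ((Lc : ℤ) • Y + toSite v)
          + sgnK (trK ((stepScale 3 Lc 0 * (Lc : ℝ) ^ (3 + 1))⁻¹ • ∑ v ∈ box (3 + 1) Lc, divV (fun κ u => cB • vh₂S κ u κ' u') ((Lc : ℤ) • Y + toSite v))) =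
        (2 : ℝ) • (comp ((-((Lc : ℝ) ^ (3 + 1) * (1 / 2) * (Lc : ℝ) ^ (3 + 1))) • vhSAt (toSite (ctrOff (3 + 1) Lc)) 3 Lc rfl κ' u')
            (diagK (((1 : ℝ) / 2) • ∑ v ∈ box (3 + 1) Lc, legInd (toSite (ctrOff (3 + 1) Lc)) ((Lc : ℤ) • Y + toSite v)))
          - comp (diagK (((1 : ℝ) / 2) • ∑ v ∈ box (3 + 1) Lc, legInd (toSite (ctrOff (3 + 1) Lc)) ((Lc : ℤ) • Y + toSite v)))
            ((-((Lc : ℝ) ^ (3 + 1) * (1 / 2) * (Lc : ℝ) ^ (3 + 1))) • vhSAt (toSite (ctrOff (3 + 1) Lc)) 3 Lc rfl κ' u'))) : False :=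
  no_twin_ward_border_evenHalf_model_zero (e := 1) (τ := 3) (μ := 0) hLc rfl (by decide) cB hBtw hE0

/-- [folklore] **THE WALL'S `d = 3` INSTANCE, LEVEL `j + 1`** (`τ = 3`, `μ = 0`; hES of p220943 at one level, `r := ctrOff 4 Lc`). -/
theorem no_twin_ward_border_evenHalf_model_succ_three {Lc : ℕ} [NeZero Lc] (hLc : 2 ≤ Lc) (cB : ℝ) (j : ℕ)
    {vh₂S : Fin 4 → (Fin 4 → ℤ) → Fin 4 → (Fin 4 → ℤ) → MKer 4 (Fib 3)}
    (hBtw : ∀ κ u κ' u' (x z : Fin 4 → ℤ) (β m : Fin 4),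
      vh₂S κ u κ' u' z x (Sum.inr m) (Sum.inl β) = vh₂S κ u κ' u' x z (Sum.inl β) (Sum.inr m))
    (hES : ∀ (Y : Fin 4 → ℤ) (κ' : Fin 4) (u' : Fin 4 → ℤ),
      (stepScale 3 Lc (j + 1) * (Lc : ℝ) ^ (3 + 1))⁻¹ •
            ∑ v ∈ box (3 + 1) Lc, divV (fun κ u => (cB * wB2 3 Lc (j + 1)) • vh₂S κ u κ' u') ((Lc : ℤ) • Y + toSite v)
          + sgnK (trK ((stepScale 3 Lc (j + 1) * (Lc : ℝ) ^ (3 + 1))⁻¹ •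
            ∑ v ∈ box (3 + 1) Lc, divV (fun κ u => (cB * wB2 3 Lc (j + 1)) • vh₂S κ u κ' u') ((Lc : ℤ) • Y + toSite v))) =
        (2 : ℝ) • (comp ((-((Lc : ℝ) ^ (3 + 1) * (1 / 2) * (Lc : ℝ) ^ (3 + 1)) * wVH 3 Lc (j + 1)) • vhSAt (toSite (ctrOff (3 + 1) Lc)) 3 Lc rfl κ' u')
            (diagK (((1 : ℝ) / 2) • ∑ v ∈ box (3 + 1) Lc, legInd (toSite (ctrOff (3 + 1) Lc)) ((Lc : ℤ) • Y + toSite v)))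
          - comp (diagK (((1 : ℝ) / 2) • ∑ v ∈ box (3 + 1) Lc, legInd (toSite (ctrOff (3 + 1) Lc)) ((Lc : ℤ) • Y + toSite v)))
            ((-((Lc : ℝ) ^ (3 + 1) * (1 / 2) * (Lc : ℝ) ^ (3 + 1)) * wVH 3 Lc (j + 1)) • vhSAt (toSite (ctrOff (3 + 1) Lc)) 3 Lc rfl κ' u'))) :
    False :=
  no_twin_ward_border_evenHalf_model_succ (e := 1) (τ := 3) (μ := 0) hLc rfl (by decide) cB j hBtw hES

end

end Summit.QuantumFields.BalabanUV.Beta.WardBorderNoTwinParity
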